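import Summits.QuantumFields.BalabanUV.T4Continuum.Support.NE7GaugeSliceInstance
import Summits.QuantumFields.BalabanUV.T4Continuum.Support.NE7FibreCoordinates
import Summits.QuantumFields.BalabanUV.T4Continuum.Support.NE7FibreStraightening
import Summits.QuantumFields.BalabanUV.T4Continuum.Support.NE7LevelQGaugeInvariance
import HarnessLib

/-!
# NE7SliceStraightening — FIBRE COORDINATES ON THE GAUGE SLICE (ROAD-G114 §9 (S3b)): at an interior `U♯ ∈ admissible(D₀)` with straightening `θ` (✓ p821389
# `NE7FibreStraightening.fibre_straightening`) and gauge slice `(Σ, ξ, σ)` through `U♯` (✓ p823659 `NE7GaugeSliceInstance.gauge_slice`), the map `θ_Σ(y, s) := P_Σ σ(θ(y, s))`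
# (`s ∈ Σ`, `P_Σ` a linear projection onto `Σ`, the identity on `σ`'s values) is a straightening of `Q̄|_Σ`: `Q̄(θ_Σ(y,s)) = y` with class membership and admissibility over every
# nearby datum `D` with `y(D) = y` (EXACT data invariance of trivial-corner gauges, ✓ p823513), and `θ_Σ(Q̄ s, s) = s` (slice uniqueness); `Q̄′|_Σ` is onto (✓ p823844
# `levelQ'_gaugeDir_eq_zero` + the slice decomposition); hence `NE7FibreCoordinates.fibre_coordinates` (✓ p823167) gives slice-fibre coordinates `π_Σ : Σ → ker Q̄′|_Σ`, `C²`,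
# with `θ_Σ(Q̄ s, π_Σ s) = s` and `π_Σ(θ_Σ(y, z)) = z` near `0`

Cell `pub-balaban`, rung (B)+1 sub-cell t4, lineage `b2b-balaban-t4-ne7-p1` (CRUX PROVER NE7 #1 = OWNER of BINDER row NE7), generation 114.  Memo `t4/b2b-balaban-t4-ne7-p1-g114/ROAD-G114.md` §9.
WHAT ([folklore]; 0 def, 0 sorry; `d = 4`).  **`slice_straightening`** — the input of (S4)–(S6) (quadratic growth on `ker Q̄′|_Σ`, implicit critical point, minimality ⇒ `C¹` minimal action at
generic data).
HONEST FRAMING (page 1): soft calculus over landed letters; radii existential; nothing of Bałaban's; NOT NE7, NOT NE3; spine 0∕9; finite T⁴ rung (B)+1 — NOT infinite volume, NOT mass gap, NOT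
BetaPertH, NOT Clay.
-/

set_option autoImplicit false

open scoped BigOperators Matrix Matrix.Norms.L2Operator Topology
open NormedSpace Finset Set Filter Metric

namespace Summit.QuantumFields.BalabanUV.T4Continuum.NE7SliceStraightening

open Literature.MathematicalPhysics.QuantumFieldTheory.Balaban1983to89
open B7Prop1Explicit B7Prop2Explicit MatrixLog
open T4AveragingDeficitWall (IsUnitaryCfg SmallField)
open T4AveragingDeficitWallBoundary (IsPeriodicCfg)
open AveragingDeficitTorusChart (TDir chart chart_zero redN isUnitaryCfg_chart isPeriodicCfg_chart)
open AveragingDeficitChartCalculus (relLog)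
open AveragingDeficitTwoLevelPrep (skewSub mem_skewSub skewPR)
open AveragingDeficitMultiLevelPrep (tower levelQ levelQ' levelQ_self LevelSmall tower_ne_zero)
open AveragingDeficitMultiLevelFermat (hasStrictFDerivAt_levelQ levelQ'_onto)
open AveragingDeficitFermat (eventually_smallField_chart)
open MinimalActionSandwich (admissible)
open MinimalActionRate (sfClass)
open NE7AdmissibleFibreLHC (chart_id_eq_chart_skewP period_succ_eq)
open NE7FibreStraightening (fibre_straightening)
open NE7FibreCoordinates (fibre_coordinates)
open NE7GaugeActionChart (gaugeChart_val)
open NE7GaugeSliceMapFacts (levelQ_sliceMap sliceMap_zero_gauge chart_sliceMap avgIter_gaugeAct_trivialCorner)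
open NE7GaugeSliceInstance (gauge_slice)
open NE7LevelQGaugeInvariance (levelQ'_gaugeDir_eq_zero)

noncomputable section

variable {n : Type} [Fintype n] [DecidableEq n]

set_option maxHeartbeats 1600000 in
/-- **SLICE STRAIGHTENING AND SLICE-FIBRE COORDINATES** at an interior admissible `U♯` (see the module docstring): the gauge slice `(Σ, ξ, σ)` through `U♯` — `Σ` presented as a
linear subspace `Sl ≤ skewSub` of the chart model space — the straightening `θ_Σ : skewSub N × Σ → Σ` of the `(j+1)`-fold-average coordinate restricted to `Σ` (with class membership
and admissibility over nearby data), its onto differential `Q̄′|_Σ`, and `C²` fibre coordinates `π_Σ : Σ → ker Q̄′|_Σ`. [folklore] -/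
theorem slice_straightening [Nonempty n] {L N : ℕ} [NeZero L] [NeZero N] (hL : 1 ≤ L) {ε a : ℝ} (hε : 0 ≤ ε) (j : ℕ)
    (hls : LevelSmall 4 L j (ε / ((L : ℝ) ^ (j + 1)) ^ 2)) {D₀ Us : Site 4 → Fin 4 → (Matrix n n ℂ)ˣ}
    (hUs : Us ∈ admissible (sfClass 4 L N ε) L (j + 1) D₀) (haε : a < ε / ((L : ℝ) ^ (j + 1)) ^ 2) (hUsa : SmallField Us a) :
    ∃ (Sl : Submodule ℝ (TDir 4 n (L * tower L N j)))
      (ξ : ↥(skewSub 4 n (L * tower L N j)) → ((Fin 4 → Fin (L * tower L N j)) → Matrix n n ℂ))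
      (σ : ↥(skewSub 4 n (L * tower L N j)) → ↥(skewSub 4 n (L * tower L N j)))
      (θS : ↥(skewSub 4 n N) × ↥Sl → ↥Sl) (G' : ↥Sl →L[ℝ] ↥(skewSub 4 n N))
      (π : ↥Sl → ↥(LinearMap.ker (G' : ↥Sl →ₗ[ℝ] ↥(skewSub 4 n N)))),
      Sl ≤ skewSub 4 n (L * tower L N j) ∧
      -- the gauge slice through `U♯` (S2)
      ContDiffAt ℝ 2 ξ 0 ∧ ContDiffAt ℝ 2 σ 0 ∧ ξ 0 = 0 ∧ σ 0 = 0 ∧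
      (∀ Φ, (∀ r, ξ Φ r ∈ skewAdjoint (Matrix n n ℂ)) ∧ (∀ w : Site 4, ξ Φ (redN (L * tower L N j) (((L : ℤ) ^ (j + 1)) • w)) = 0) ∧
        ((σ Φ : ↥(skewSub 4 n (L * tower L N j))) : TDir 4 n (L * tower L N j)) ∈ Sl) ∧
      (∀ᶠ Φ : ↥(skewSub 4 n (L * tower L N j)) in 𝓝 0,
        skewPR (L * tower L N j) (relLog (L * tower L N j) Us (gaugeAct (fun x : Site 4 => expUnit (ξ Φ (redN (L * tower L N j) x)))
          (chart (ContinuousLinearMap.id ℝ (Matrix n n ℂ)) (L * tower L N j) Us (σ Φ : TDir 4 n (L * tower L N j))))) = Φ) ∧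
      (∀ᶠ p : ((Fin 4 → Fin (L * tower L N j)) → Matrix n n ℂ) × ↥(skewSub 4 n (L * tower L N j)) in 𝓝 0,
        (∀ r, p.1 r ∈ skewAdjoint (Matrix n n ℂ)) → (∀ w : Site 4, p.1 (redN (L * tower L N j) (((L : ℤ) ^ (j + 1)) • w)) = 0) →
          (p.2 : TDir 4 n (L * tower L N j)) ∈ Sl →
          ξ (skewPR (L * tower L N j) (relLog (L * tower L N j) Us (gaugeAct (fun x : Site 4 => expUnit (p.1 (redN (L * tower L N j) x)))
              (chart (ContinuousLinearMap.id ℝ (Matrix n n ℂ)) (L * tower L N j) Us (p.2 : TDir 4 n (L * tower L N j)))))) = p.1 ∧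
          σ (skewPR (L * tower L N j) (relLog (L * tower L N j) Us (gaugeAct (fun x : Site 4 => expUnit (p.1 (redN (L * tower L N j) x)))
              (chart (ContinuousLinearMap.id ℝ (Matrix n n ℂ)) (L * tower L N j) Us (p.2 : TDir 4 n (L * tower L N j)))))) = p.2) ∧
      -- the straightening on the slice (S3)
      ContDiffAt ℝ 2 θS 0 ∧ θS 0 = 0 ∧
      HasFDerivAt (fun s : ↥Sl => levelQ L N j Us (chart (ContinuousLinearMap.id ℝ (Matrix n n ℂ)) (L * tower L N j) Us (s : TDir 4 n (L * tower L N j)))) G' 0 ∧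
      LinearMap.range (G' : ↥Sl →ₗ[ℝ] ↥(skewSub 4 n N)) = ⊤ ∧
      (∀ᶠ p : ↥(skewSub 4 n N) × ↥Sl in 𝓝 0,
        levelQ L N j Us (chart (ContinuousLinearMap.id ℝ (Matrix n n ℂ)) (L * tower L N j) Us ((θS p : ↥Sl) : TDir 4 n (L * tower L N j))) = p.1 ∧
        chart (ContinuousLinearMap.id ℝ (Matrix n n ℂ)) (L * tower L N j) Us ((θS p : ↥Sl) : TDir 4 n (L * tower L N j)) ∈ sfClass 4 L N ε (j + 1) ∧
        ∀ D : Site 4 → Fin 4 → (Matrix n n ℂ)ˣ, IsUnitaryCfg D → IsPeriodicCfg D (N : ℤ) →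
          (∀ (r : Fin 4 → Fin N) (κ' : Fin 4),
            ‖(((D₀ (boxVec N r) κ')⁻¹ : (Matrix n n ℂ)ˣ) : Matrix n n ℂ) * (D (boxVec N r) κ' : Matrix n n ℂ) - 1‖ ≤ 1 / 4) →
          skewPR N (relLog N D₀ D) = p.1 →
          chart (ContinuousLinearMap.id ℝ (Matrix n n ℂ)) (L * tower L N j) Us ((θS p : ↥Sl) : TDir 4 n (L * tower L N j))
            ∈ admissible (sfClass 4 L N ε) L (j + 1) D) ∧
      (∀ᶠ s : ↥Sl in 𝓝 0, θS (levelQ L N j Us (chart (ContinuousLinearMap.id ℝ (Matrix n n ℂ)) (L * tower L N j) Us (s : TDir 4 n (L * tower L N j))), s) = s) ∧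
      -- fibre coordinates on the slice (P1)
      ContDiffAt ℝ 2 π 0 ∧ π 0 = 0 ∧
      (∀ᶠ s : ↥Sl in 𝓝 0,
        θS (levelQ L N j Us (chart (ContinuousLinearMap.id ℝ (Matrix n n ℂ)) (L * tower L N j) Us (s : TDir 4 n (L * tower L N j))), (π s : ↥Sl)) = s) ∧
      (∀ᶠ q : ↥(skewSub 4 n N) × ↥(LinearMap.ker (G' : ↥Sl →ₗ[ℝ] ↥(skewSub 4 n N))) in 𝓝 0, π (θS (q.1, (q.2 : ↥Sl))) = q.2) := by
  haveI : NeZero (L * tower L N j) := ⟨Nat.mul_ne_zero (NeZero.ne L) (tower_ne_zero L N j)⟩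
  letI : NormedAlgebra ℚ (Matrix n n ℂ) := NormedAlgebra.restrictScalars ℚ ℂ (Matrix n n ℂ)
  have hx : 0 ≤ ε / ((L : ℝ) ^ (j + 1)) ^ 2 := by positivity
  have hUs' := hUs
  obtain ⟨⟨hUsu, hUsP, hUsx⟩, -⟩ := hUs'
  have hUsPM : IsPeriodicCfg Us ((L * tower L N j : ℕ) : ℤ) := by rw [← period_succ_eq]; exact hUsP
  have eP : ((L * tower L N j : ℕ) : ℤ) = (L : ℤ) * (tower L N j : ℕ) := by push_cast; ring
  have hUsP' : IsPeriodicCfg Us ((L : ℤ) * (tower L N j : ℕ)) := by rw [← eP]; exact hUsPM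
  -- (S2) the slice and (F5) the straightening
  obtain ⟨Sg, ξ, σ, hξc, hσc, hξ0, hσ0, hprop, hright, hleft, hdec, -⟩ := gauge_slice (L := L) (N := N) j hUsu
  obtain ⟨θ, K, ρ₀, -, hρ₀, hθ0, hθc, -, hθid, hθfib⟩ := fibre_straightening (d := 4) hL hε hls hUs haε hUsa
  -- the slice as a subspace `Sl` of the chart model space, the inclusion `Sl → skewSub` and a projection `skewSub → Sl`
  set Sl : Submodule ℝ (TDir 4 n (L * tower L N j)) := Sg.map (skewSub 4 n (L * tower L N j)).subtype with hSl
  have hSlle : Sl ≤ skewSub 4 n (L * tower L N j) := Submodule.map_subtype_le _ _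
  have hmemSl : ∀ v : ↥(skewSub 4 n (L * tower L N j)), (v : TDir 4 n (L * tower L N j)) ∈ Sl ↔ v ∈ Sg := fun v => by
    constructor
    · rintro ⟨y, hy, hyv⟩
      have hyv' : y = v := Subtype.ext (by simpa using hyv)
      rw [← hyv']; exact hy
    · intro hv; exact ⟨v, hv, rfl⟩
  haveI : CompleteSpace ↥Sl := FiniteDimensional.complete ℝ _
  set incl : ↥Sl →L[ℝ] ↥(skewSub 4 n (L * tower L N j)) := LinearMap.toContinuousLinearMap (Submodule.inclusion hSlle) with hincl
  have hinclv : ∀ s : ↥Sl, ((incl s : ↥(skewSub 4 n (L * tower L N j))) : TDir 4 n (L * tower L N j)) = (s : TDir 4 n (L * tower L N j)) := fun s => rfl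
  have hinclm : ∀ s : ↥Sl, incl s ∈ Sg := fun s => (hmemSl (incl s)).mp s.2
  obtain ⟨Qc, hQc⟩ := Sg.exists_isCompl
  set P : ↥(skewSub 4 n (L * tower L N j)) →L[ℝ] ↥Sl := LinearMap.toContinuousLinearMap
    ((Submodule.equivMapOfInjective (skewSub 4 n (L * tower L N j)).subtype (skewSub 4 n (L * tower L N j)).injective_subtype Sg).toLinearMap
      ∘ₗ Sg.projectionOnto Qc hQc) with hPdef
  have hP : ∀ v : ↥(skewSub 4 n (L * tower L N j)), v ∈ Sg → ((P v : ↥Sl) : TDir 4 n (L * tower L N j)) = (v : TDir 4 n (L * tower L N j)) := fun v hv => by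
    show ((Submodule.equivMapOfInjective (skewSub 4 n (L * tower L N j)).subtype (skewSub 4 n (L * tower L N j)).injective_subtype Sg
      (Sg.projectionOnto Qc hQc v) : ↥Sl) : TDir 4 n (L * tower L N j)) = (v : TDir 4 n (L * tower L N j))
    rw [Submodule.projectionOnto_apply_of_mem_left hQc hv, Submodule.coe_equivMapOfInjective_apply]; rfl
  -- the slice straightening `θ_Σ`
  set ι : ↥(skewSub 4 n N) × ↥Sl →L[ℝ] ↥(skewSub 4 n N) × ↥(skewSub 4 n (L * tower L N j)) :=
    (ContinuousLinearMap.id ℝ ↥(skewSub 4 n N)).prodMap incl with hι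
  have hι0 : ι 0 = 0 := map_zero ι
  set θS : ↥(skewSub 4 n N) × ↥Sl → ↥Sl := fun p => P (σ (θ (ι p))) with hθS
  have hθSval : ∀ p, ((θS p : ↥Sl) : TDir 4 n (L * tower L N j)) = ((σ (θ (ι p)) : ↥(skewSub 4 n (L * tower L N j))) : TDir 4 n (L * tower L N j)) :=
    fun p => hP _ (hprop _).2.2
  have hθιc : ContDiffAt ℝ 2 (fun p : ↥(skewSub 4 n N) × ↥Sl => θ (ι p)) 0 := by
    have h1 : ContDiffAt ℝ 2 θ (ι 0) := by rw [hι0]; exact hθc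
    exact h1.comp 0 ι.contDiff.contDiffAt
  have hθι0 : θ (ι 0) = 0 := by rw [hι0, hθ0]
  have hσθc : ContDiffAt ℝ 2 (fun p : ↥(skewSub 4 n N) × ↥Sl => σ (θ (ι p))) 0 := by
    have h1 : ContDiffAt ℝ 2 σ ((fun p : ↥(skewSub 4 n N) × ↥Sl => θ (ι p)) 0) := by simp only [hθι0]; exact hσc
    exact ContDiffAt.comp (f := fun p : ↥(skewSub 4 n N) × ↥Sl => θ (ι p)) 0 h1 hθιc
  have hξθc : ContDiffAt ℝ 2 (fun p : ↥(skewSub 4 n N) × ↥Sl => ξ (θ (ι p))) 0 := by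
    have h1 : ContDiffAt ℝ 2 ξ ((fun p : ↥(skewSub 4 n N) × ↥Sl => θ (ι p)) 0) := by simp only [hθι0]; exact hξc
    exact ContDiffAt.comp (f := fun p : ↥(skewSub 4 n N) × ↥Sl => θ (ι p)) 0 h1 hθιc
  have hθSc : ContDiffAt ℝ 2 θS 0 := P.contDiff.contDiffAt.comp 0 hσθc
  have hθS0 : θS 0 = 0 := by simp only [hθS, hι0, hθ0, hσ0, map_zero]
  -- the constraint on the slice and its onto differential
  set G : ↥Sl → ↥(skewSub 4 n N) := fun s => levelQ L N j Us (chart (ContinuousLinearMap.id ℝ (Matrix n n ℂ)) (L * tower L N j) Us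
    (s : TDir 4 n (L * tower L N j))) with hG
  set G' : ↥Sl →L[ℝ] ↥(skewSub 4 n N) := (levelQ' L N j Us).comp Sl.subtypeL with hG'
  have hQs := hasStrictFDerivAt_levelQ (d := 4) (n := n) (M' := N) hL j hUsu hUsP' hx hls hUsx
  have hGd : HasFDerivAt G G' 0 := by
    have hJ0 : Sl.subtypeL 0 = 0 := map_zero _
    have h1 : HasFDerivAt (fun Φ : TDir 4 n (L * tower L N j) => levelQ L N j Us (chart (ContinuousLinearMap.id ℝ (Matrix n n ℂ)) (L * tower L N j) Us Φ))
        (levelQ' L N j Us) (Sl.subtypeL 0) := by rw [hJ0]; exact hQs.hasFDerivAt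
    exact h1.comp 0 Sl.subtypeL.hasFDerivAt
  have hG0 : G 0 = 0 := by simp only [hG, Submodule.coe_zero, chart_zero, levelQ_self]
  have hrange : LinearMap.range (G' : ↥Sl →ₗ[ℝ] ↥(skewSub 4 n N)) = ⊤ := by
    refine LinearMap.range_eq_top.mpr fun γ => ?_
    obtain ⟨Φ, hΦs, hΦ⟩ := levelQ'_onto (d := 4) (n := n) (M' := N) hL j hUsu hUsP' hx hls hUsx γ
    obtain ⟨ζ, τ, hζ, hζc, hτ, hv⟩ := hdec ⟨Φ, mem_skewSub.mpr hΦs⟩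
    refine ⟨⟨(τ : TDir 4 n (L * tower L N j)), (hmemSl τ).mpr hτ⟩, ?_⟩
    have hkill := levelQ'_gaugeDir_eq_zero (n := n) hL hε j hls hUsu hUsPM haε hUsa hζ hζc
    have hΦeq : Φ = (((skewPR (L * tower L N j) (fun r κ =>
        (((Us (boxVec (L * tower L N j) r) κ)⁻¹ : (Matrix n n ℂ)ˣ) : Matrix n n ℂ) * ζ r * (Us (boxVec (L * tower L N j) r) κ : Matrix n n ℂ)
          - ζ (redN (L * tower L N j) (boxVec (L * tower L N j) r + e κ))) : ↥(skewSub 4 n (L * tower L N j))) : TDir 4 n (L * tower L N j)))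
        + ((τ : ↥(skewSub 4 n (L * tower L N j))) : TDir 4 n (L * tower L N j)) := by
      have h := congrArg Subtype.val hv
      simpa only [Submodule.coe_add] using h
    show G' ⟨(τ : TDir 4 n (L * tower L N j)), (hmemSl τ).mpr hτ⟩ = γ
    have e1 : G' ⟨(τ : TDir 4 n (L * tower L N j)), (hmemSl τ).mpr hτ⟩
        = levelQ' L N j Us ((τ : ↥(skewSub 4 n (L * tower L N j))) : TDir 4 n (L * tower L N j)) := rfl
    rw [e1, ← hΦ, hΦeq, map_add, hkill, zero_add]
  -- continuity of the bond values of `(chart Φ)^{exp ζ}` in `(ζ, Φ)`, and the decoding nearness near `0`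
  have hcont : ∀ (r : Fin 4 → Fin (L * tower L N j)) (κ : Fin 4), Continuous fun q : ((Fin 4 → Fin (L * tower L N j)) → Matrix n n ℂ) × TDir 4 n (L * tower L N j) =>
      (((Us (boxVec (L * tower L N j) r) κ)⁻¹ : (Matrix n n ℂ)ˣ) : Matrix n n ℂ) * (exp (q.1 r) * ((Us (boxVec (L * tower L N j) r) κ : Matrix n n ℂ) * exp (q.2 r κ))
        * exp (-(q.1 (redN (L * tower L N j) (boxVec (L * tower L N j) r + e κ))))) := by
    intro r κ
    have e1 : Continuous fun q : ((Fin 4 → Fin (L * tower L N j)) → Matrix n n ℂ) × TDir 4 n (L * tower L N j) => q.1 r :=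
      (continuous_apply r).comp continuous_fst
    have e2' : Continuous fun q : ((Fin 4 → Fin (L * tower L N j)) → Matrix n n ℂ) × TDir 4 n (L * tower L N j) => q.2 r :=
      (continuous_apply r).comp continuous_snd
    have e2 : Continuous fun q : ((Fin 4 → Fin (L * tower L N j)) → Matrix n n ℂ) × TDir 4 n (L * tower L N j) => q.2 r κ :=
      (continuous_apply κ).comp e2'
    have e3 : Continuous fun q : ((Fin 4 → Fin (L * tower L N j)) → Matrix n n ℂ) × TDir 4 n (L * tower L N j) =>
        q.1 (redN (L * tower L N j) (boxVec (L * tower L N j) r + e κ)) := (continuous_apply _).comp continuous_fst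
    exact continuous_const.mul (((NormedSpace.exp_continuous.comp e1).mul (continuous_const.mul (NormedSpace.exp_continuous.comp e2))).mul
      (NormedSpace.exp_continuous.comp e3.neg))
  have hnearq : ∀ᶠ q : ((Fin 4 → Fin (L * tower L N j)) → Matrix n n ℂ) × TDir 4 n (L * tower L N j) in 𝓝 0,
      ∀ (r : Fin 4 → Fin (L * tower L N j)) (κ : Fin 4), ‖(((Us (boxVec (L * tower L N j) r) κ)⁻¹ : (Matrix n n ℂ)ˣ) : Matrix n n ℂ)
        * ((gaugeAct (fun x : Site 4 => expUnit (q.1 (redN (L * tower L N j) x))) (chart (ContinuousLinearMap.id ℝ (Matrix n n ℂ)) (L * tower L N j) Us q.2)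
            (boxVec (L * tower L N j) r) κ : (Matrix n n ℂ)ˣ) : Matrix n n ℂ) - 1‖ ≤ 1 / 4 := by
    refine Filter.eventually_all.mpr fun r => Filter.eventually_all.mpr fun κ => ?_
    have h0 : ‖(((Us (boxVec (L * tower L N j) r) κ)⁻¹ : (Matrix n n ℂ)ˣ) : Matrix n n ℂ)
        * (exp ((0 : ((Fin 4 → Fin (L * tower L N j)) → Matrix n n ℂ) × TDir 4 n (L * tower L N j)).1 r)
          * ((Us (boxVec (L * tower L N j) r) κ : Matrix n n ℂ) * exp ((0 : ((Fin 4 → Fin (L * tower L N j)) → Matrix n n ℂ) × TDir 4 n (L * tower L N j)).2 r κ))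
          * exp (-((0 : ((Fin 4 → Fin (L * tower L N j)) → Matrix n n ℂ) × TDir 4 n (L * tower L N j)).1
            (redN (L * tower L N j) (boxVec (L * tower L N j) r + e κ))))) - 1‖ < 1 / 4 := by
      simp only [Prod.fst_zero, Prod.snd_zero, Pi.zero_apply, exp_zero, neg_zero, one_mul, mul_one, Units.inv_mul, sub_self, norm_zero]; norm_num
    have hev := ((((hcont r κ).sub continuous_const).norm).continuousAt
      (x := (0 : ((Fin 4 → Fin (L * tower L N j)) → Matrix n n ℂ) × TDir 4 n (L * tower L N j)))).eventually (gt_mem_nhds h0)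
    filter_upwards [hev] with q hq
    rw [gaugeChart_val]
    exact hq.le
  -- limits along `p ↦ θ(ι p)` and its slice decomposition
  have htθ : Tendsto (fun p : ↥(skewSub 4 n N) × ↥Sl => θ (ι p)) (𝓝 0) (𝓝 0) := by
    have h := hθιc.continuousAt; rw [ContinuousAt] at h; simp only [hθι0] at h; exact h
  have htσ : Tendsto (fun p : ↥(skewSub 4 n N) × ↥Sl => ((σ (θ (ι p)) : ↥(skewSub 4 n (L * tower L N j))) : TDir 4 n (L * tower L N j))) (𝓝 0) (𝓝 0) := by
    have h := hσθc.continuousAt; rw [ContinuousAt] at h; simp only [hθι0, hσ0] at h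
    have h2 := ((skewSub 4 n (L * tower L N j)).subtypeL.continuous.tendsto (0 : ↥(skewSub 4 n (L * tower L N j)))).comp h
    rw [map_zero] at h2; exact h2
  have htξ : Tendsto (fun p : ↥(skewSub 4 n N) × ↥Sl => ξ (θ (ι p))) (𝓝 0) (𝓝 0) := by
    have h := hξθc.continuousAt; rw [ContinuousAt] at h; simp only [hθι0, hξ0] at h; exact h
  have htΛ : Tendsto (fun p : ↥(skewSub 4 n N) × ↥Sl => (ξ (θ (ι p)), ((σ (θ (ι p)) : ↥(skewSub 4 n (L * tower L N j))) : TDir 4 n (L * tower L N j))))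
      (𝓝 0) (𝓝 0) := by
    have h := htξ.prodMk_nhds htσ; rwa [Prod.mk_zero_zero] at h
  have htι : Tendsto (fun p : ↥(skewSub 4 n N) × ↥Sl => ι p) (𝓝 0) (𝓝 0) := by
    have h := ι.continuous.tendsto 0; rwa [hι0] at h
  have hballι : ∀ᶠ q : ↥(skewSub 4 n N) × ↥(skewSub 4 n (L * tower L N j)) in 𝓝 0, ‖q‖ < ρ₀ :=
    Filter.eventually_of_mem (Metric.ball_mem_nhds _ hρ₀) fun q hq => by rwa [mem_ball_zero_iff] at hq
  have hsmall : ∀ᶠ ψ : TDir 4 n (L * tower L N j) in 𝓝 0,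
      SmallField (chart (ContinuousLinearMap.id ℝ (Matrix n n ℂ)) (L * tower L N j) Us ψ) (ε / ((L : ℝ) ^ (j + 1)) ^ 2) :=
    eventually_smallField_chart (ContinuousLinearMap.id ℝ (Matrix n n ℂ)) (L * tower L N j) hUsPM haε hUsa
  -- the fibre identity on the slice, with class membership and admissibility
  have hfibS : ∀ᶠ p : ↥(skewSub 4 n N) × ↥Sl in 𝓝 0,
      levelQ L N j Us (chart (ContinuousLinearMap.id ℝ (Matrix n n ℂ)) (L * tower L N j) Us ((θS p : ↥Sl) : TDir 4 n (L * tower L N j))) = p.1 ∧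
      chart (ContinuousLinearMap.id ℝ (Matrix n n ℂ)) (L * tower L N j) Us ((θS p : ↥Sl) : TDir 4 n (L * tower L N j)) ∈ sfClass 4 L N ε (j + 1) ∧
      ∀ D : Site 4 → Fin 4 → (Matrix n n ℂ)ˣ, IsUnitaryCfg D → IsPeriodicCfg D (N : ℤ) →
        (∀ (r : Fin 4 → Fin N) (κ' : Fin 4),
          ‖(((D₀ (boxVec N r) κ')⁻¹ : (Matrix n n ℂ)ˣ) : Matrix n n ℂ) * (D (boxVec N r) κ' : Matrix n n ℂ) - 1‖ ≤ 1 / 4) →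
        skewPR N (relLog N D₀ D) = p.1 →
        chart (ContinuousLinearMap.id ℝ (Matrix n n ℂ)) (L * tower L N j) Us ((θS p : ↥Sl) : TDir 4 n (L * tower L N j))
          ∈ admissible (sfClass 4 L N ε) L (j + 1) D := by
    filter_upwards [htι.eventually hballι, htθ.eventually hright, htΛ.eventually hnearq, htσ.eventually hsmall] with p hρ hr hn hs
    have hζ := (hprop (θ (ι p))).1
    have hζc := (hprop (θ (ι p))).2.1
    have hchu : IsUnitaryCfg (chart (ContinuousLinearMap.id ℝ (Matrix n n ℂ)) (L * tower L N j) Us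
        ((σ (θ (ι p)) : ↥(skewSub 4 n (L * tower L N j))) : TDir 4 n (L * tower L N j))) := by
      rw [chart_id_eq_chart_skewP Us (σ (θ (ι p))).2]; exact isUnitaryCfg_chart (L * tower L N j) hUsu _
    have hchP : IsPeriodicCfg (chart (ContinuousLinearMap.id ℝ (Matrix n n ℂ)) (L * tower L N j) Us
        ((σ (θ (ι p)) : ↥(skewSub 4 n (L * tower L N j))) : TDir 4 n (L * tower L N j))) ((N * L ^ (j + 1) : ℕ) : ℤ) := by
      rw [period_succ_eq]; exact isPeriodicCfg_chart _ (L * tower L N j) hUsPM _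
    have hΦcl : chart (ContinuousLinearMap.id ℝ (Matrix n n ℂ)) (L * tower L N j) Us
        ((σ (θ (ι p)) : ↥(skewSub 4 n (L * tower L N j))) : TDir 4 n (L * tower L N j)) ∈ sfClass 4 L N ε (j + 1) := ⟨hchu, hchP, hs⟩
    obtain ⟨hf1, -, hf3⟩ := hθfib (ι p) hρ
    have hdecode := chart_sliceMap hUsu hUsPM hζ (σ (θ (ι p))) hn
    rw [hr] at hdecode
    have hlev := levelQ_sliceMap (n := n) hL hε j hls hUsu hUsPM hζ hζc (σ (θ (ι p))) hΦcl hn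
    rw [hr] at hlev
    rw [hθSval p]
    refine ⟨by rw [← hlev, hf1]; rfl, hΦcl, fun D hDu hDP hDn hDy => ⟨hΦcl, ?_⟩⟩
    have hadm := hf3 D hDu hDP hDn hDy
    have havg := avgIter_gaugeAct_trivialCorner hL hε j hls hΦcl hζ hζc
    rw [← hdecode] at havg
    rw [← havg]; exact hadm.2
  -- the section identity on the slice
  have hsecS : ∀ᶠ s : ↥Sl in 𝓝 0, θS (G s, s) = s := by
    have hts : Tendsto (fun s : ↥Sl => incl s) (𝓝 0) (𝓝 0) := by
      have h := incl.continuous.tendsto (0 : ↥Sl); rwa [map_zero] at h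
    have ht0s : Tendsto (fun s : ↥Sl => ((0 : (Fin 4 → Fin (L * tower L N j)) → Matrix n n ℂ), incl s)) (𝓝 0) (𝓝 0) := by
      have h := (tendsto_const_nhds (x := (0 : (Fin 4 → Fin (L * tower L N j)) → Matrix n n ℂ)) (f := (𝓝 (0 : ↥Sl)))).prodMk_nhds hts
      rwa [Prod.mk_zero_zero] at h
    have hballρ : ∀ᶠ v : ↥(skewSub 4 n (L * tower L N j)) in 𝓝 0, ‖v‖ < ρ₀ :=
      Filter.eventually_of_mem (Metric.ball_mem_nhds _ hρ₀) fun q hq => by rwa [mem_ball_zero_iff] at hq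
    have hball2 : ∀ᶠ v : ↥(skewSub 4 n (L * tower L N j)) in 𝓝 0, ‖v‖ < Real.log 2 :=
      Filter.eventually_of_mem (Metric.ball_mem_nhds _ (Real.log_pos (by norm_num : (1 : ℝ) < 2))) fun q hq => by rwa [mem_ball_zero_iff] at hq
    filter_upwards [hts.eventually hballρ, hts.eventually hball2, ht0s.eventually hleft] with s hρ hlog hl
    have h1 : θ (ι (G s, s)) = incl s := hθid (incl s) hρ
    have h2 : σ (incl s) = incl s := by
      have h := (hl (fun r => (skewAdjoint (Matrix n n ℂ)).zero_mem) (fun w => rfl) (hinclm s)).2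
      rw [sliceMap_zero_gauge Us (incl s) hlog] at h
      exact h
    apply Subtype.ext
    rw [hθSval, h1, h2]
    exact hinclv s
  -- fibre coordinates on the slice
  obtain ⟨π, hπc, hπ0, hπsec, hπfib⟩ :=
    fibre_coordinates (S := ↥Sl) (Y := ↥(skewSub 4 n N)) hG0 hGd hrange hθSc hθS0 (hfibS.mono fun p hp => hp.1) hsecS
  refine ⟨Sl, ξ, σ, θS, G', π, hSlle, hξc, hσc, hξ0, hσ0, fun Φ => ⟨(hprop Φ).1, (hprop Φ).2.1, (hmemSl (σ Φ)).mpr (hprop Φ).2.2⟩, hright,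
    hleft.mono fun p hp h1 h2 h3 => hp h1 h2 ((hmemSl p.2).mp h3), hθSc, hθS0, hGd, hrange, hfibS, hsecS, hπc, hπ0, hπsec, hπfib⟩

end

end Summit.QuantumFields.BalabanUV.T4Continuum.NE7SliceStraightening
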